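import Mathlib
import Summits.ValiantsHypothesis.ValiantsHypothesis.Theorems.RigidityForcesSymmetryRankRigidMinimalReprLaplaceFiveThreeSlicesNormalize
import Summits.ValiantsHypothesis.ValiantsHypothesis.Theorems.RigidityForcesSymmetryRankRigidMinimalReprLaplaceFiveThreeSlicesSorted
import Summits.ValiantsHypothesis.ValiantsHypothesis.Theorems.RigidityForcesSymmetryRankRigidMinimalReprLaplaceFiveThreeSlicesCoreInstances
import Summits.ValiantsHypothesis.ValiantsHypothesis.Theorems.RigidityForcesSymmetryRankRigidMinimalReprLaplaceContract

/-!
# `LaplaceOptimalFive`: a cheap decomposition of `P₅` with three slices is one of four residual configurations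
# (crux `RankRigidMinimalRepr`, stmt-ValiantsHypothesis-18034; frontier rung `LaplaceOptimalFive`, stmt-24813)

The `a = 3` class of the frontier rung `LaplaceOptimal 5` («Laplace expansion is optimal for the permutation pattern
of order 5»), in the OFFICIAL data format of the item:

* `laplace_five_three_slices_residual` — if split-rank-one terms sum to `[v injective]` on `Fin 5 → Fin 5` with total
  Laplace weight `< 120` and exactly three of them are slices, then in the sorted labelled normal form
  (`three_slices_normalize`) the configuration `(c; p0 q0, p1 q1, p2 q2)` (slot pattern `I c` of the slices, sorted
  oriented pair cuts) is one of FOUR residual configurations, all with the slices on three DISTINCT slots `(0,1,2)`: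
  the triangle `{01,02,12}` and the three labellings `{01,02,34}`, `{01,12,34}`, `{02,12,34}` of «two cuts inside the
  slice slots plus the outside cut».  Every other one of the `3 × 220` configurations is refuted by a kernel-checked
  argument: an interleaved dual certificate (`three_slices_sorted_A/B/C`, val-width-24813-w1, 633 configurations), a
  support-core certificate (`core_*`, 10), or the CONTRACTION count `contract_five` with `laplaceOptimal_four` (13: all
  configurations with the slices on one slot, and the `(x,x,y)` ones whose cuts do not all pass through `x`).
* `laplace_five_at_most_two_slices_of_residual` — CONDITIONAL form of «a cheap decomposition of `P₅` has at most two
  slices»: it holds as soon as the four residual configurations are refuted (hypothesis `hres`, one finite statement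
  per configuration in the normal-form format; for them both certificate engines are one unit over capacity at exactly
  one position and contraction gives `26`–`28 ≥ 24`).

HONEST FRAMING: an exact PARTIAL result toward the frontier rung `LaplaceOptimalFive` (stmt-24813: weight `≥ 120`, i.e.
no cheap decomposition at all), a support item of ONE route; with `laplace_five_at_most_three_slices`: a cheap
decomposition has `≤ 3` slices and, if `3`, one of 4 labelled shapes.  The item stays OPEN; the numerics of record are
two-sided; nothing here bears on `VP ≠ VNP`, which is NOT proved.
-/

set_option autoImplicit false

-- the mandated summit-side namespace repeats a component by design (single-problem summit)
set_option linter.dupNamespace false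

namespace Summit.ValiantsHypothesis.ValiantsHypothesis.Theorems.RigidityForcesSymmetryRankRigidMinimalRepr

namespace LaplaceFiveSlices

open Finset

/-- **Three slices ⇒ one of four residual configurations.**  In the data format of `LaplaceOptimal 5`: if the terms
sum to the pattern with total Laplace weight `< 120` and exactly three of them are slices, then the sorted labelled
normal form `[v inj] = Σ_k α_k(v_{I c k}) W_k(v) + Σ_t u_t(v_{p t}, v_{q t}) w_t(v)` has its configuration
`(c, p0, q0, p1, q1, p2, q2)` among `(0; 0,1, 0,2, 1,2)`, `(0; 0,1, 0,2, 3,4)`, `(0; 0,1, 1,2, 3,4)`, `(0; 0,2, 1,2, 3,4)`. -/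
theorem laplace_five_three_slices_residual {N : ℕ} (T : Finset (Fin N)) (S : Fin N → Finset (Fin 5))
    (u w : Fin N → (Fin 5 → Fin 5) → ℂ)
    (hu : ∀ t, ∀ v v' : Fin 5 → Fin 5, (∀ i ∈ S t, v i = v' i) → u t v = u t v')
    (hw : ∀ t, ∀ v v' : Fin 5 → Fin 5, (∀ i, i ∉ S t → v i = v' i) → w t v = w t v')
    (hsum : ∀ v : Fin 5 → Fin 5, (∑ t ∈ T, u t v * w t v) = if Function.Injective v then 1 else 0)
    (hlt : ∑ t ∈ T, (S t).card.factorial * (5 - (S t).card).factorial < 120)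
    (h3 : (T.filter (fun t => (S t).card = 1 ∨ (S t).card = 4)).card = 3) :
    ∃ (c : Fin 3) (p0 q0 p1 q1 p2 q2 : Fin 5) (α : Fin 3 → Fin 5 → ℂ) (W : Fin 3 → (Fin 5 → Fin 5) → ℂ)
      (u' w' : Fin 3 → (Fin 5 → Fin 5) → ℂ),
      (c, p0, q0, p1, q1, p2, q2) ∈ ([(0, 0, 1, 0, 2, 1, 2), (0, 0, 1, 0, 2, 3, 4), (0, 0, 1, 1, 2, 3, 4), (0, 0, 2, 1, 2, 3, 4)] : List (Fin 3 × Fin 5 × Fin 5 × Fin 5 × Fin 5 × Fin 5 × Fin 5)) ∧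
      (∀ k, ∀ v v' : Fin 5 → Fin 5, (∀ j, j ≠ (![![0, 1, 2], ![0, 0, 1], ![0, 0, 0]] : Fin 3 → Fin 3 → Fin 5) c k → v j = v' j) → W k v = W k v') ∧
      (∀ t, ∀ v v' : Fin 5 → Fin 5, v ((![p0, p1, p2] : Fin 3 → Fin 5) t) = v' ((![p0, p1, p2] : Fin 3 → Fin 5) t) →
        v ((![q0, q1, q2] : Fin 3 → Fin 5) t) = v' ((![q0, q1, q2] : Fin 3 → Fin 5) t) → u' t v = u' t v') ∧
      (∀ t, ∀ v v' : Fin 5 → Fin 5, (∀ j, j ≠ (![p0, p1, p2] : Fin 3 → Fin 5) t →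
        j ≠ (![q0, q1, q2] : Fin 3 → Fin 5) t → v j = v' j) → w' t v = w' t v') ∧
      ∀ v : Fin 5 → Fin 5, (if Function.Injective v then (1 : ℂ) else 0) =
        (∑ k, α k (v ((![![0, 1, 2], ![0, 0, 1], ![0, 0, 0]] : Fin 3 → Fin 3 → Fin 5) c k)) * W k v) + ∑ t, u' t v * w' t v := by
  classical
  obtain ⟨c, α, W, p, q, u', w', hW, hpq, hsort, hu', hw', H⟩ :=
    three_slices_normalize T S u w hu hw hsum hlt h3
  -- components of the cuts
  obtain ⟨p0, hp0⟩ : ∃ x, p 0 = x := ⟨_, rfl⟩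
  obtain ⟨p1, hp1⟩ : ∃ x, p 1 = x := ⟨_, rfl⟩
  obtain ⟨p2, hp2⟩ : ∃ x, p 2 = x := ⟨_, rfl⟩
  obtain ⟨q0, hq0⟩ : ∃ x, q 0 = x := ⟨_, rfl⟩
  obtain ⟨q1, hq1⟩ : ∃ x, q 1 = x := ⟨_, rfl⟩
  obtain ⟨q2, hq2⟩ : ∃ x, q 2 = x := ⟨_, rfl⟩
  have h0 : p0 < q0 := by rw [← hp0, ← hq0]; exact hpq 0
  have h1 : p1 < q1 := by rw [← hp1, ← hq1]; exact hpq 1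
  have h2 : p2 < q2 := by rw [← hp2, ← hq2]; exact hpq 2
  have hs1 : (p0 : ℕ) * 5 + q0 ≤ (p1 : ℕ) * 5 + q1 := by
    have hq : (q0 : ℕ) < 5 := q0.isLt
    rcases hsort 0 1 (by decide) with h | ⟨h, h'⟩
    · rw [hp0, hp1, Fin.lt_def] at h; omega
    · rw [hp0, hp1] at h; rw [hq0, hq1, Fin.le_def] at h'; rw [h]; omega
  have hs2 : (p1 : ℕ) * 5 + q1 ≤ (p2 : ℕ) * 5 + q2 := by
    have hq : (q1 : ℕ) < 5 := q1.isLt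
    rcases hsort 1 2 (by decide) with h | ⟨h, h'⟩
    · rw [hp1, hp2, Fin.lt_def] at h; omega
    · rw [hp1, hp2] at h; rw [hq1, hq2, Fin.le_def] at h'; rw [h]; omega
  have hpv : p = ![p0, p1, p2] := by
    funext t; fin_cases t <;> simp [hp0, hp1, hp2]
  have hqv : q = ![q0, q1, q2] := by
    funext t; fin_cases t <;> simp [hq0, hq1, hq2]
  rw [hpv, hqv] at hu' hw'
  refine ⟨c, p0, q0, p1, q1, p2, q2, α, W, u', w', ?_, hW, hu', hw', H⟩
  by_contra hnot
  -- every non-residual configuration is refuted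
  rcases (by decide : ∀ c : Fin 3, c = 0 ∨ c = 1 ∨ c = 2) c with rfl | rfl | rfl
  · -- slot pattern ![0, 1, 2]
    have hI : (![![0, 1, 2], ![0, 0, 1], ![0, 0, 0]] : Fin 3 → Fin 3 → Fin 5) 0 = (![0, 1, 2] : Fin 3 → Fin 5) := rfl
    simp only [hI] at hW H
    by_cases hexc : (p0, q0, p1, q1, p2, q2) ∈ ([
        (0, 1, 0, 1, 0, 1),
        (0, 1, 0, 2, 1, 2),
        (0, 1, 0, 2, 3, 4),
        (0, 1, 1, 2, 3, 4),
        (0, 2, 0, 2, 0, 2),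
        (0, 2, 1, 2, 3, 4),
        (1, 2, 1, 2, 1, 2)] :
        List (Fin 5 × Fin 5 × Fin 5 × Fin 5 × Fin 5 × Fin 5))
    · simp only [List.mem_cons, Prod.mk.injEq, List.not_mem_nil, or_false] at hexc
      rcases hexc with ⟨rfl, rfl, rfl, rfl, rfl, rfl⟩ |
        ⟨rfl, rfl, rfl, rfl, rfl, rfl⟩ |
        ⟨rfl, rfl, rfl, rfl, rfl, rfl⟩ |
        ⟨rfl, rfl, rfl, rfl, rfl, rfl⟩ |
        ⟨rfl, rfl, rfl, rfl, rfl, rfl⟩ |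
        ⟨rfl, rfl, rfl, rfl, rfl, rfl⟩ |
        ⟨rfl, rfl, rfl, rfl, rfl, rfl⟩
      · exact core_A_01_01_01 α W hW u' w' hu' hw' H
      · exact hnot (by decide)
      · exact hnot (by decide)
      · exact hnot (by decide)
      · exact core_A_02_02_02 α W hW u' w' hu' hw' H
      · exact hnot (by decide)
      · exact core_A_12_12_12 α W hW u' w' hu' hw' H
    · exact three_slices_sorted_C p0 q0 p1 q1 p2 q2 h0 h1 h2 hs1 hs2 hexc α W hW u' w' hu' hw' H
  · -- slot pattern ![0, 0, 1]
    have hI : (![![0, 1, 2], ![0, 0, 1], ![0, 0, 0]] : Fin 3 → Fin 3 → Fin 5) 1 = (![0, 0, 1] : Fin 3 → Fin 5) := rfl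
    simp only [hI] at hW H
    by_cases hexc : (p0, q0, p1, q1, p2, q2) ∈ ([
        (0, 1, 0, 1, 0, 1),
        (1, 2, 1, 3, 1, 4),
        (1, 2, 2, 3, 2, 4),
        (1, 3, 2, 3, 3, 4),
        (1, 4, 2, 4, 3, 4),
        (2, 3, 2, 4, 3, 4)] :
        List (Fin 5 × Fin 5 × Fin 5 × Fin 5 × Fin 5 × Fin 5))
    · simp only [List.mem_cons, Prod.mk.injEq, List.not_mem_nil, or_false] at hexc
      rcases hexc with ⟨rfl, rfl, rfl, rfl, rfl, rfl⟩ |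
        ⟨rfl, rfl, rfl, rfl, rfl, rfl⟩ |
        ⟨rfl, rfl, rfl, rfl, rfl, rfl⟩ |
        ⟨rfl, rfl, rfl, rfl, rfl, rfl⟩ |
        ⟨rfl, rfl, rfl, rfl, rfl, rfl⟩ |
        ⟨rfl, rfl, rfl, rfl, rfl, rfl⟩
      · exact core_B_01_01_01 α W hW u' w' hu' hw' H
      · exact LaplaceContract.three_slices_contract ![0, 0, 1] α W hW ![1, 1, 1] ![2, 3, 4] (by decide) u' w' hu' hw' 0
          (by decide) (by decide) H
      · exact LaplaceContract.three_slices_contract ![0, 0, 1] α W hW ![1, 2, 2] ![2, 3, 4] (by decide) u' w' hu' hw' 0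
          (by decide) (by decide) H
      · exact LaplaceContract.three_slices_contract ![0, 0, 1] α W hW ![1, 2, 3] ![3, 3, 4] (by decide) u' w' hu' hw' 0
          (by decide) (by decide) H
      · exact LaplaceContract.three_slices_contract ![0, 0, 1] α W hW ![1, 2, 3] ![4, 4, 4] (by decide) u' w' hu' hw' 0
          (by decide) (by decide) H
      · exact LaplaceContract.three_slices_contract ![0, 0, 1] α W hW ![2, 2, 3] ![3, 4, 4] (by decide) u' w' hu' hw' 0
          (by decide) (by decide) H
    · exact three_slices_sorted_B p0 q0 p1 q1 p2 q2 h0 h1 h2 hs1 hs2 hexc α W hW u' w' hu' hw' H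
  · -- slot pattern ![0, 0, 0]
    have hI : (![![0, 1, 2], ![0, 0, 1], ![0, 0, 0]] : Fin 3 → Fin 3 → Fin 5) 2 = (![0, 0, 0] : Fin 3 → Fin 5) := rfl
    simp only [hI] at hW H
    by_cases hexc : (p0, q0, p1, q1, p2, q2) ∈ ([
        (1, 2, 1, 2, 3, 4),
        (1, 2, 1, 3, 1, 4),
        (1, 2, 1, 3, 2, 3),
        (1, 2, 1, 4, 2, 4),
        (1, 2, 2, 3, 2, 4),
        (1, 2, 3, 4, 3, 4),
        (1, 3, 1, 3, 2, 4),
        (1, 3, 1, 4, 3, 4),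
        (1, 3, 2, 3, 3, 4),
        (1, 3, 2, 4, 2, 4),
        (1, 4, 1, 4, 2, 3),
        (1, 4, 2, 3, 2, 3),
        (1, 4, 2, 4, 3, 4),
        (2, 3, 2, 4, 3, 4)] :
        List (Fin 5 × Fin 5 × Fin 5 × Fin 5 × Fin 5 × Fin 5))
    · simp only [List.mem_cons, Prod.mk.injEq, List.not_mem_nil, or_false] at hexc
      rcases hexc with ⟨rfl, rfl, rfl, rfl, rfl, rfl⟩ |
        ⟨rfl, rfl, rfl, rfl, rfl, rfl⟩ |
        ⟨rfl, rfl, rfl, rfl, rfl, rfl⟩ |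
        ⟨rfl, rfl, rfl, rfl, rfl, rfl⟩ |
        ⟨rfl, rfl, rfl, rfl, rfl, rfl⟩ |
        ⟨rfl, rfl, rfl, rfl, rfl, rfl⟩ |
        ⟨rfl, rfl, rfl, rfl, rfl, rfl⟩ |
        ⟨rfl, rfl, rfl, rfl, rfl, rfl⟩ |
        ⟨rfl, rfl, rfl, rfl, rfl, rfl⟩ |
        ⟨rfl, rfl, rfl, rfl, rfl, rfl⟩ |
        ⟨rfl, rfl, rfl, rfl, rfl, rfl⟩ |
        ⟨rfl, rfl, rfl, rfl, rfl, rfl⟩ |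
        ⟨rfl, rfl, rfl, rfl, rfl, rfl⟩ |
        ⟨rfl, rfl, rfl, rfl, rfl, rfl⟩
      · exact core_C_12_12_34 α W hW u' w' hu' hw' H
      · exact LaplaceContract.three_slices_contract ![0, 0, 0] α W hW ![1, 1, 1] ![2, 3, 4] (by decide) u' w' hu' hw' 0
          (by decide) (by decide) H
      · exact LaplaceContract.three_slices_contract ![0, 0, 0] α W hW ![1, 1, 2] ![2, 3, 3] (by decide) u' w' hu' hw' 0
          (by decide) (by decide) H
      · exact LaplaceContract.three_slices_contract ![0, 0, 0] α W hW ![1, 1, 2] ![2, 4, 4] (by decide) u' w' hu' hw' 0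
          (by decide) (by decide) H
      · exact LaplaceContract.three_slices_contract ![0, 0, 0] α W hW ![1, 2, 2] ![2, 3, 4] (by decide) u' w' hu' hw' 0
          (by decide) (by decide) H
      · exact core_C_12_34_34 α W hW u' w' hu' hw' H
      · exact core_C_13_13_24 α W hW u' w' hu' hw' H
      · exact LaplaceContract.three_slices_contract ![0, 0, 0] α W hW ![1, 1, 3] ![3, 4, 4] (by decide) u' w' hu' hw' 0
          (by decide) (by decide) H
      · exact LaplaceContract.three_slices_contract ![0, 0, 0] α W hW ![1, 2, 3] ![3, 3, 4] (by decide) u' w' hu' hw' 0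
          (by decide) (by decide) H
      · exact core_C_13_24_24 α W hW u' w' hu' hw' H
      · exact core_C_14_14_23 α W hW u' w' hu' hw' H
      · exact core_C_14_23_23 α W hW u' w' hu' hw' H
      · exact LaplaceContract.three_slices_contract ![0, 0, 0] α W hW ![1, 2, 3] ![4, 4, 4] (by decide) u' w' hu' hw' 0
          (by decide) (by decide) H
      · exact LaplaceContract.three_slices_contract ![0, 0, 0] α W hW ![2, 2, 3] ![3, 4, 4] (by decide) u' w' hu' hw' 0
          (by decide) (by decide) H
    · exact three_slices_sorted_A p0 q0 p1 q1 p2 q2 h0 h1 h2 hs1 hs2 hexc α W hW u' w' hu' hw' H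

/-- **«At most two slices», conditional on the four residual configurations.**  If each of the four residual sorted
labelled configurations is refuted (hypothesis `hres`, in the normal-form format), then in the data format of
`LaplaceOptimal 5` a decomposition of total Laplace weight `< 120` has at most two slice terms. -/
theorem laplace_five_at_most_two_slices_of_residual
    (hres : ∀ (c : Fin 3) (p0 q0 p1 q1 p2 q2 : Fin 5),
      (c, p0, q0, p1, q1, p2, q2) ∈ ([(0, 0, 1, 0, 2, 1, 2), (0, 0, 1, 0, 2, 3, 4), (0, 0, 1, 1, 2, 3, 4), (0, 0, 2, 1, 2, 3, 4)] : List (Fin 3 × Fin 5 × Fin 5 × Fin 5 × Fin 5 × Fin 5 × Fin 5)) →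
      ∀ (α : Fin 3 → Fin 5 → ℂ) (W : Fin 3 → (Fin 5 → Fin 5) → ℂ),
        (∀ k, ∀ v v' : Fin 5 → Fin 5, (∀ j, j ≠ (![![0, 1, 2], ![0, 0, 1], ![0, 0, 0]] : Fin 3 → Fin 3 → Fin 5) c k → v j = v' j) → W k v = W k v') →
        ∀ (u' w' : Fin 3 → (Fin 5 → Fin 5) → ℂ),
          (∀ t, ∀ v v' : Fin 5 → Fin 5, v ((![p0, p1, p2] : Fin 3 → Fin 5) t) = v' ((![p0, p1, p2] : Fin 3 → Fin 5) t) →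
            v ((![q0, q1, q2] : Fin 3 → Fin 5) t) = v' ((![q0, q1, q2] : Fin 3 → Fin 5) t) → u' t v = u' t v') →
          (∀ t, ∀ v v' : Fin 5 → Fin 5, (∀ j, j ≠ (![p0, p1, p2] : Fin 3 → Fin 5) t →
            j ≠ (![q0, q1, q2] : Fin 3 → Fin 5) t → v j = v' j) → w' t v = w' t v') →
          ¬ ∀ v : Fin 5 → Fin 5, (if Function.Injective v then (1 : ℂ) else 0) =
            (∑ k, α k (v ((![![0, 1, 2], ![0, 0, 1], ![0, 0, 0]] : Fin 3 → Fin 3 → Fin 5) c k)) * W k v) + ∑ t, u' t v * w' t v)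
    {N : ℕ} (T : Finset (Fin N)) (S : Fin N → Finset (Fin 5))
    (u w : Fin N → (Fin 5 → Fin 5) → ℂ)
    (hu : ∀ t, ∀ v v' : Fin 5 → Fin 5, (∀ i ∈ S t, v i = v' i) → u t v = u t v')
    (hw : ∀ t, ∀ v v' : Fin 5 → Fin 5, (∀ i, i ∉ S t → v i = v' i) → w t v = w t v')
    (hsum : ∀ v : Fin 5 → Fin 5, (∑ t ∈ T, u t v * w t v) = if Function.Injective v then 1 else 0)
    (hlt : ∑ t ∈ T, (S t).card.factorial * (5 - (S t).card).factorial < 120) :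
    (T.filter (fun t => (S t).card = 1 ∨ (S t).card = 4)).card ≤ 2 := by
  have h3 := laplace_five_at_most_three_slices T S u w hu hw hsum hlt
  by_contra hgt
  have heq : (T.filter (fun t => (S t).card = 1 ∨ (S t).card = 4)).card = 3 := by omega
  obtain ⟨c, p0, q0, p1, q1, p2, q2, α, W, u', w', hmem, hW, hu', hw', H⟩ :=
    laplace_five_three_slices_residual T S u w hu hw hsum hlt heq
  exact hres c p0 q0 p1 q1 p2 q2 hmem α W hW u' w' hu' hw' H

end LaplaceFiveSlices

end Summit.ValiantsHypothesis.ValiantsHypothesis.Theorems.RigidityForcesSymmetryRankRigidMinimalRepr
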